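/-
Copyright (c) 2026 the pub-hodgecm-mathlib formalisation cell (harness21).  Prover seat hodgecm-mathlib-F0P3a-p03 (g21): line LH7 (closer row `stub_PKtupleK2`, #181 III-127;
h413 = stmt-HodgeConjecture-24833), leaf ED. 3 road, the isotypy letter (O8b♭) at the finite places — FULL LOCAL ISOTYPY by the «DET-SCALAR» road; 2026-09-02.
-/
import Summits.HodgeConjecture.HodgeConjecture.Theorems.F0P3cPKtupleU2LocalIsotypyCompact   -- ★ p850240 (this lineage, g20): `isConstituentOf_iff_of_realises₂` (+ ★ (β) `Realises₂`, ★ (γ′) `cmDetChar` plumbing)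
import Literature.NumberTheory.Automorphic.SmoothRepUniqueConstituentDetScalar                -- ★ p850416 (this seat): `IrrClass.apply_eq_smul_of_forall_isConstituentOf_eq_mk_ofChar_of_forall_exists_sq_mul_inv_mem_closure`
import Literature.NumberTheory.Automorphic.UnitaryGroupLocalDetScalar                         -- ★ p850430 (this seat): `scalar_det_mem_localPi`, `inclPlaceAdelic_scalar_det_mem_center`, `det_apply_mul_mul_scalar_det_inv_eq_one`, `det_apply_commutator_eq_one`
import HarnessLib

/-!
# LH7 leaf ED. 3, (O8b♭) at the finite places — `Realises₂ P₂ ξ` ⇒ ALL of `U(Φ₂)(L⁺_v)` acts on the finite-adelic smooth vectors of `P₂` through `((η ψ) ∘ det) ∘ ι_v`,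
# granted only that the norm-one-determinant part `SU_v` of `U(Φ₂)(L⁺_v)` is generated by compact subgroups ([Rogawski1990] §13.3 p. 203)

Cell `pub/hodgecm-mathlib` (D-0151), crux H413 = `stmt-HodgeConjecture-24833`, half A line LH7, leaf ED. 3 road (LH7-plan (g2) `MEMO-ED3.v2` §7 (c); this lineage's census
`F0/P3a/F0P3a-p03/g20/CENSUS-O8b-PKmultOneU2.F0P3ap03g20.md` + ADDENDUM).  THEOREMS ONLY (kernel lane; no `def`, no instance, no notation, no named fact, no `sorry`).
THE O8b SPLIT: O8b `PKmultOneU2Shape L` = (O8b♯) LINE UNIQUENESS [★ p850105 ∕ p850173] + (O8b♭) ISOTYPY «`Realises₂ P₂ ξ ⇒ U(Φ₂)(𝔸)` acts on `P₂` by `(η ψ)(det g)`» [PRINT].  (O8b♭) has a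
LOCAL part (i) «`U(Φ₂)(L⁺_v)` acts on `P₂^∞` by `χ_v := ((η ψ) ∘ det) ∘ ι_v` at every finite `v`», a restricted-product part (ii) and an archimedean part (iii) (weak approximation).  ★ p850240
proved (i) for the COMPACT subgroups of `U(Φ₂)(L⁺_v)`.  THIS FILE proves (i) for ALL of `U(Φ₂)(L⁺_v)`, uniformly in `v` (split or not), modulo ONE group-theoretic input per place:

  (SU-GEN)_v  every `u ∈ U(Φ₂)(L⁺_v)` (Π-model ★ `localPi … v ≤ Π_{w ∣ v} GL₂(L_w)`) all of whose components have determinant `1` lies in `G°_v := ⟨K ≤ U(Φ₂)(L⁺_v) | K ⊆ compact⟩`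
              (binder `hSU`; at a split `v` this is «`SL₂(L_w)` is generated by transvections, each in a compact subgroup» — ★ `DicksonGLTwoTransvections` + ★ `GLnCompactSubgroupsGenerate`
              along ★ `localPiSplitEquiv`; at a non-split `v` the `SU(1,1)(L_w ∕ L⁺_v)` twin — both discharged in the sequel, not here).

THE MATHEMATICS («DET-SCALAR» road, ★ `SmoothRepUniqueConstituentDetScalar`).  Fix a finite place `v` and write `G_v := U(Φ₂)(L⁺_v)`, `ρ_v := P₂^∞|_{G_v}` (`P₂.finRep.smoothPart ∘ inclPlace v`,
smooth), `χ_v := ((η ψ) ∘ det) ∘ ι_v`.  `Realises₂ P₂ ξ` says the constituents of `ρ_v` are exactly `{⟦ℂ_{χ_v}⟧}` (★ `isConstituentOf_iff_of_realises₂`).  For `g ∈ G_v` let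
`z_g := (det g_w · 1₂)_{w ∣ v}` — an element of `G_v` (★ `scalar_det_mem_localPi`) whose image `ι_v(z_g)` is CENTRAL in `U(Φ₂)(𝔸)` (★ `inclPlaceAdelic_scalar_det_mem_center`), so by Schur
(★ `IsTopIrreducible.exists_apply_eq_smul_of_commute` on the irreducible unitary `P₂ ≤ L²`) it acts on `P₂`, hence on `ρ_v`, by a scalar (§1).  Every component of `g g z_g⁻¹` and of every
commutator `k⁻¹ g⁻¹ k g` has determinant `1` (★ `det_apply_mul_mul_scalar_det_inv_eq_one`, ★ `det_apply_commutator_eq_one`), so (SU-GEN)_v puts them in `G°_v`, and ★ p850416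
`IrrClass.apply_eq_smul_of_forall_isConstituentOf_eq_mk_ofChar_of_forall_exists_sq_mul_inv_mem_closure` yields `ρ_v(g) = χ_v(g)` for EVERY `g ∈ G_v` (§2).  No unitarity of `ρ_v`, no
«`G_v = ⟨G°_v, diag(ϖ,1)⟩`», no case distinction between split and non-split places, no weak∕strong approximation.
* §1 `exists_toContRep_inclPlaceAdelic_scalar_det_apply_eq_smul` — Schur for `ι_v(z_g)` on `P₂`; `exists_scalar_det_smoothPart_apply_eq_smul` — the same on `ρ_v`;
* §2 **`finRep_smoothPart_inclPlace_apply_eq_smul_of_realises₂_of_su`** — `Realises₂ P₂ ξ`, (SU-GEN)_v ⇒ `ρ_v(g) f = χ_v(g) • f` for ALL `g ∈ G_v`; `toContRep_inclPlaceAdelic_apply_eq_smul_of_realises₂_of_su`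
  (the same on the `L²` vectors `P₂.space.toContRep (ι_v g) f` for `f` finite-adelic smooth).
WHAT REMAINS of (O8b♭) after this file (honest): the discharge of (SU-GEN)_v (sequel; in-house, Mathlib + ★ only), (ii) places → `U(Φ₂)(𝔸_f)` [L], (iii) the archimedean component [PRINT:
weak approximation for `U(Φ₂)` at `∞`].  HONEST LABEL: count-neutral; HC_CM is proved only modulo the 7 printed citations (2 remaining: hLiu418 = stmt-HodgeConjecture-24832, h413 =
stmt-HodgeConjecture-24833) until rung 0 closes.

## References
* [Rogawski1990] J. D. Rogawski, *Automorphic Representations of Unitary Groups in Three Variables* (1990), §13.3 pp. 202–203 (`m(ξ) = 1`), §12.2 pp. 173–174.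
* [BushnellHenniart2006] C. J. Bushnell, G. Henniart, *The local Langlands conjecture for GL(2)* (2006), §2.3 Lemma, §9.1, §9.2.
* [DeitmarEchterhoff2014] A. Deitmar, S. Echterhoff, *Principles of Harmonic Analysis*, 2nd ed. (2014), Lemma 6.1.7 (Schur).
* [BorelJacquet1979] A. Borel, H. Jacquet, Corvallis (1979), §4.1, §4.6.
-/

set_option autoImplicit false
-- the mandated namespace repeats the single-problem summit's segment (`HodgeConjecture.HodgeConjecture`)
set_option linter.dupNamespace false

noncomputable section

namespace Summit.HodgeConjecture.HodgeConjecture.Cruxes.H413.F0P3cPKtupleU2LocalIsotypy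

open MeasureTheory NumberField IsDedekindDomain
open Literature.NumberTheory Literature.NumberTheory.Automorphic Literature.NumberTheory.Automorphic.UnitaryGroup
open Literature.NumberTheory.Rogawski1990 Literature.NumberTheory.GaloisRepresentations
open Literature.NumberTheory.Automorphic.Arthur2013.Leaves.TECR
open Summit.HodgeConjecture.HodgeConjecture.Cruxes.H413.F0P3GlobalPacketDiscrete
open Summit.HodgeConjecture.HodgeConjecture.Cruxes.H413.F0P3cPKtupleHSideLetters
open Summit.HodgeConjecture.HodgeConjecture.Cruxes.H413.F0P3cPKtupleU1Line
open Summit.HodgeConjecture.HodgeConjecture.Cruxes.H413.F0P3cPKtupleU2LocalIsotypyCompact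

variable {L : Type} [Field L] [NumberField L] [IsCMField L]

/-! ## §1 Schur: the determinant scalar `ι_v(z_g)` acts on `P₂` by a scalar -/

/-- **Schur for the determinant scalar.**  For a discrete automorphic `P₂` of `U(Φ₂)`, a finite place `v` and `g ∈ U(Φ₂)(L⁺_v)`, the central element `ι_v(z_g)`, `z_g = (det g_w · 1₂)_w`
(★ `scalar_det_mem_localPi`, ★ `inclPlaceAdelic_scalar_det_mem_center`), acts on `P₂ ≤ L²(U(Φ₂)(L⁺) \ U(Φ₂)(𝔸))` by a scalar: `P₂` is topologically irreducible and unitary (★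
`isUnitary_rightRegular`), and `R(ι_v z_g)|_{P₂}` commutes with `R(U(Φ₂)(𝔸))|_{P₂}` (★ `IsTopIrreducible.exists_apply_eq_smul_of_commute`).
[cite: DeitmarEchterhoff2014, Lemma 6.1.7] [cite: BorelJacquet1979, §4.6] -/
theorem exists_toContRep_inclPlaceAdelic_scalar_det_apply_eq_smul
    {μ₂ : Measure (adelicGroupData ↥(maximalRealSubfield L) L (IsCMField.complexConj L) 2 (Matrix.of fun i j : Fin 2 => if i.val + j.val + 1 = 2 then (1 : L) else 0)).automorphicQuotient}
    [(adelicGroupData ↥(maximalRealSubfield L) L (IsCMField.complexConj L) 2 (Matrix.of fun i j : Fin 2 => if i.val + j.val + 1 = 2 then (1 : L) else 0)).IsAutomorphicMeasure μ₂]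
    (P₂ : DiscreteAutomorphicRep (adelicGroupData ↥(maximalRealSubfield L) L (IsCMField.complexConj L) 2 (Matrix.of fun i j : Fin 2 => if i.val + j.val + 1 = 2 then (1 : L) else 0)) μ₂)
    (v : HeightOneSpectrum (𝓞 ↥(maximalRealSubfield L))) (g : ↥(localPi L (IsCMField.complexConj L) 2 (Matrix.of fun i j : Fin 2 => if i.val + j.val + 1 = 2 then (1 : L) else 0) v)) :
    ∃ a : ℂ, ∀ f : ↥P₂.space.toSubmodule,
      P₂.space.toContRep (inclPlaceAdelic ↥(maximalRealSubfield L) L (IsCMField.complexConj L) 2 (Matrix.of fun i j : Fin 2 => if i.val + j.val + 1 = 2 then (1 : L) else 0) v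
        ⟨fun w : PlacesOver L v =>
          Units.map (Matrix.scalar (Fin 2) : w.1.adicCompletion L →+* Matrix (Fin 2) (Fin 2) (w.1.adicCompletion L)).toMonoidHom
            (Matrix.GeneralLinearGroup.det ((g : LocalGLPi L 2 v) w)),
          scalar_det_mem_localPi L (IsCMField.complexConj L) 2 (Matrix.of fun i j : Fin 2 => if i.val + j.val + 1 = 2 then (1 : L) else 0) (isUnit_antidiagOne_det L 2).ne_zero v g⟩) f = a • f := by
  haveI : CompleteSpace ↥P₂.space.toSubmodule := P₂.space.isClosed.completeSpace_coe
  have hU : P₂.space.toContRep.IsUnitary := ((adelicGroupData ↥(maximalRealSubfield L) L (IsCMField.complexConj L) 2 (Matrix.of fun i j : Fin 2 => if i.val + j.val + 1 = 2 then (1 : L) else 0)).isUnitary_rightRegular μ₂).toContRep P₂.space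
  have hz := inclPlaceAdelic_scalar_det_mem_center L (IsCMField.complexConj L) 2 (Matrix.of fun i j : Fin 2 => if i.val + j.val + 1 = 2 then (1 : L) else 0) (isUnit_antidiagOne_det L 2).ne_zero v g
  exact P₂.irreducible.exists_apply_eq_smul_of_commute hU (T := P₂.space.toContRep _) fun g' => by
    change P₂.space.toContRep g' * P₂.space.toContRep _ = P₂.space.toContRep _ * P₂.space.toContRep g'
    rw [← map_mul, ← map_mul, Subgroup.mem_center_iff.1 hz g']

/-- **The determinant scalar acts on `ρ_v = P₂^∞|_{U(Φ₂)(L⁺_v)}` by a scalar** (§1 restricted to the finite-adelic smooth vectors; `P₂.finRep (inclPlace v u) = P₂.space.toContRep (ι_v u)`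
definitionally). [cite: DeitmarEchterhoff2014, Lemma 6.1.7] [cite: BorelJacquet1979, §4.6] -/
theorem exists_scalar_det_smoothPart_apply_eq_smul
    {μ₂ : Measure (adelicGroupData ↥(maximalRealSubfield L) L (IsCMField.complexConj L) 2 (Matrix.of fun i j : Fin 2 => if i.val + j.val + 1 = 2 then (1 : L) else 0)).automorphicQuotient}
    [(adelicGroupData ↥(maximalRealSubfield L) L (IsCMField.complexConj L) 2 (Matrix.of fun i j : Fin 2 => if i.val + j.val + 1 = 2 then (1 : L) else 0)).IsAutomorphicMeasure μ₂]
    (P₂ : DiscreteAutomorphicRep (adelicGroupData ↥(maximalRealSubfield L) L (IsCMField.complexConj L) 2 (Matrix.of fun i j : Fin 2 => if i.val + j.val + 1 = 2 then (1 : L) else 0)) μ₂)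
    (v : HeightOneSpectrum (𝓞 ↥(maximalRealSubfield L))) (g : ↥(localPi L (IsCMField.complexConj L) 2 (Matrix.of fun i j : Fin 2 => if i.val + j.val + 1 = 2 then (1 : L) else 0) v)) :
    ∃ a : ℂ, ∀ f : ↥P₂.finRep.smoothPart.toSubmodule,
      (P₂.finRep.smoothPart.toRepresentation.comp (inclPlace ↥(maximalRealSubfield L) L (IsCMField.complexConj L) 2 (Matrix.of fun i j : Fin 2 => if i.val + j.val + 1 = 2 then (1 : L) else 0) v))
        ⟨fun w : PlacesOver L v =>
          Units.map (Matrix.scalar (Fin 2) : w.1.adicCompletion L →+* Matrix (Fin 2) (Fin 2) (w.1.adicCompletion L)).toMonoidHom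
            (Matrix.GeneralLinearGroup.det ((g : LocalGLPi L 2 v) w)),
          scalar_det_mem_localPi L (IsCMField.complexConj L) 2 (Matrix.of fun i j : Fin 2 => if i.val + j.val + 1 = 2 then (1 : L) else 0) (isUnit_antidiagOne_det L 2).ne_zero v g⟩ f = a • f := by
  refine (exists_toContRep_inclPlaceAdelic_scalar_det_apply_eq_smul P₂ v g).imp fun a ha f => Subtype.ext ?_
  have haf := ha (f : ↥P₂.space.toSubmodule)
  rw [inclPlaceAdelic_apply] at haf
  exact haf

/-! ## §2 `Realises₂ P₂ ξ` + (SU-GEN)_v ⇒ ALL of `U(Φ₂)(L⁺_v)` acts through `((η ψ) ∘ det) ∘ ι_v` -/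

/-- **FULL LOCAL ISOTYPY AT `v` (modulo (SU-GEN)_v).**  Let `P₂` be a discrete automorphic representation of `U(Φ₂)` with `Realises₂ P₂ ξ`, `v` a finite place, and suppose (SU-GEN)_v:
every `u ∈ U(Φ₂)(L⁺_v)` (Π-model: a tuple `u ∈ Π_{w ∣ v} GL₂(L_w)` with `u ∈ localPi v`) with `det u_w = 1` for all `w ∣ v` lies in the subgroup closure of `⋃ {K ≤ U(Φ₂)(L⁺_v) | IsCompact ↑K}` (`hSU`, stated on the ambient tuple so that dischargers work with matrices).  Then for EVERY `g ∈ U(Φ₂)(L⁺_v)` and every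
`U(Φ₂)(𝔸_f)`-smooth vector `f` of `P₂`: `P₂.finRep (inclPlace v g) f = (η ψ)(det (ι_v g)) • f`.  (★ p850416 with `z := z_g` — §1 gives the scalar, ★ `det_apply_mul_mul_scalar_det_inv_eq_one` ∕
★ `det_apply_commutator_eq_one` + `hSU` give `g g z_g⁻¹, k⁻¹g⁻¹kg ∈ G°_v` — and `hconst` from ★ `isConstituentOf_iff_of_realises₂`.)  The `∀ g` upgrade of ★ p850240
`finRep_smoothPart_inclPlace_apply_eq_smul_of_realises₂` (compact `K` only). [cite: Rogawski1990, §13.3 p. 203] [cite: BushnellHenniart2006, §2.3 Lemma; §9.1] -/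
theorem finRep_smoothPart_inclPlace_apply_eq_smul_of_realises₂_of_su
    {μ₂ : Measure (adelicGroupData ↥(maximalRealSubfield L) L (IsCMField.complexConj L) 2 (Matrix.of fun i j : Fin 2 => if i.val + j.val + 1 = 2 then (1 : L) else 0)).automorphicQuotient}
    [(adelicGroupData ↥(maximalRealSubfield L) L (IsCMField.complexConj L) 2 (Matrix.of fun i j : Fin 2 => if i.val + j.val + 1 = 2 then (1 : L) else 0)).IsAutomorphicMeasure μ₂]
    (P₂ : DiscreteAutomorphicRep (adelicGroupData ↥(maximalRealSubfield L) L (IsCMField.complexConj L) 2 (Matrix.of fun i j : Fin 2 => if i.val + j.val + 1 = 2 then (1 : L) else 0)) μ₂) (ξ : OneDimAutRepH L)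
    (h : Realises₂ P₂ ξ) (v : HeightOneSpectrum (𝓞 ↥(maximalRealSubfield L)))
    (hSU : ∀ (u : LocalGLPi L 2 v) (hu : u ∈ localPi L (IsCMField.complexConj L) 2 (Matrix.of fun i j : Fin 2 => if i.val + j.val + 1 = 2 then (1 : L) else 0) v),
      (∀ w : PlacesOver L v, ((u w : GL (Fin 2) (w.1.adicCompletion L)) : Matrix (Fin 2) (Fin 2) (w.1.adicCompletion L)).det = 1) →
        (⟨u, hu⟩ : ↥(localPi L (IsCMField.complexConj L) 2 (Matrix.of fun i j : Fin 2 => if i.val + j.val + 1 = 2 then (1 : L) else 0) v)) ∈ Subgroup.closure (⋃ K ∈ {K : Subgroup ↥(localPi L (IsCMField.complexConj L) 2 (Matrix.of fun i j : Fin 2 => if i.val + j.val + 1 = 2 then (1 : L) else 0) v) | IsCompact (K : Set ↥(localPi L (IsCMField.complexConj L) 2 (Matrix.of fun i j : Fin 2 => if i.val + j.val + 1 = 2 then (1 : L) else 0) v))},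
          (K : Set ↥(localPi L (IsCMField.complexConj L) 2 (Matrix.of fun i j : Fin 2 => if i.val + j.val + 1 = 2 then (1 : L) else 0) v))))
    (g : ↥(localPi L (IsCMField.complexConj L) 2 (Matrix.of fun i j : Fin 2 => if i.val + j.val + 1 = 2 then (1 : L) else 0) v)) (f : ↥P₂.finRep.smoothPart.toSubmodule) :
    P₂.finRep.smoothPart.toRepresentation (inclPlace ↥(maximalRealSubfield L) L (IsCMField.complexConj L) 2 (Matrix.of fun i j : Fin 2 => if i.val + j.val + 1 = 2 then (1 : L) else 0) v g) f =
      (((cmDetChar L 2 (Matrix.of fun i j : Fin 2 => if i.val + j.val + 1 = 2 then (1 : L) else 0) (ξ.η * ξ.ψ) (isAutomorphic_eta_mul_psi ξ) (isUnit_antidiagOne_det L 2).ne_zero)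
        (inclPlaceAdelic ↥(maximalRealSubfield L) L (IsCMField.complexConj L) 2 (Matrix.of fun i j : Fin 2 => if i.val + j.val + 1 = 2 then (1 : L) else 0) v g) : ℂˣ) : ℂ) • f := by
  -- (SU-GEN)_v feeds the two closure hypotheses of ★ p850416 (subgroup arithmetic moved to the ambient tuples by `Subgroup.coe_mul` ∕ `coe_inv`)
  have hcen : ∀ t : ↥(localPi L (IsCMField.complexConj L) 2 (Matrix.of fun i j : Fin 2 => if i.val + j.val + 1 = 2 then (1 : L) else 0) v), ∃ (z : ↥(localPi L (IsCMField.complexConj L) 2 (Matrix.of fun i j : Fin 2 => if i.val + j.val + 1 = 2 then (1 : L) else 0) v)) (a : ℂ),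
      (∀ f : ↥P₂.finRep.smoothPart.toSubmodule, (P₂.finRep.smoothPart.toRepresentation.comp (inclPlace ↥(maximalRealSubfield L) L (IsCMField.complexConj L) 2 (Matrix.of fun i j : Fin 2 => if i.val + j.val + 1 = 2 then (1 : L) else 0) v)) z f = a • f) ∧
        t * t * z⁻¹ ∈ Subgroup.closure (⋃ K ∈ {K : Subgroup ↥(localPi L (IsCMField.complexConj L) 2 (Matrix.of fun i j : Fin 2 => if i.val + j.val + 1 = 2 then (1 : L) else 0) v) | IsCompact (K : Set ↥(localPi L (IsCMField.complexConj L) 2 (Matrix.of fun i j : Fin 2 => if i.val + j.val + 1 = 2 then (1 : L) else 0) v))},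
          (K : Set ↥(localPi L (IsCMField.complexConj L) 2 (Matrix.of fun i j : Fin 2 => if i.val + j.val + 1 = 2 then (1 : L) else 0) v))) := fun t => by
    refine ⟨⟨fun w : PlacesOver L v =>
        Units.map (Matrix.scalar (Fin 2) : w.1.adicCompletion L →+* Matrix (Fin 2) (Fin 2) (w.1.adicCompletion L)).toMonoidHom
          (Matrix.GeneralLinearGroup.det ((t : LocalGLPi L 2 v) w)), scalar_det_mem_localPi L (IsCMField.complexConj L) 2 (Matrix.of fun i j : Fin 2 => if i.val + j.val + 1 = 2 then (1 : L) else 0) (isUnit_antidiagOne_det L 2).ne_zero v t⟩,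
      (exists_scalar_det_smoothPart_apply_eq_smul P₂ v t).imp fun a ha => ⟨ha, ?_⟩⟩
    have hmem := hSU ((t : LocalGLPi L 2 v) * (t : LocalGLPi L 2 v) * (fun w : PlacesOver L v =>
        Units.map (Matrix.scalar (Fin 2) : w.1.adicCompletion L →+* Matrix (Fin 2) (Fin 2) (w.1.adicCompletion L)).toMonoidHom
          (Matrix.GeneralLinearGroup.det ((t : LocalGLPi L 2 v) w)))⁻¹)
      (mul_mem (mul_mem t.2 t.2) (inv_mem (scalar_det_mem_localPi L (IsCMField.complexConj L) 2 (Matrix.of fun i j : Fin 2 => if i.val + j.val + 1 = 2 then (1 : L) else 0) (isUnit_antidiagOne_det L 2).ne_zero v t)))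
      fun w => det_apply_mul_mul_scalar_det_inv_eq_one L v (t : LocalGLPi L 2 v) w
    have heq : t * t * (⟨fun w : PlacesOver L v =>
        Units.map (Matrix.scalar (Fin 2) : w.1.adicCompletion L →+* Matrix (Fin 2) (Fin 2) (w.1.adicCompletion L)).toMonoidHom
          (Matrix.GeneralLinearGroup.det ((t : LocalGLPi L 2 v) w)), scalar_det_mem_localPi L (IsCMField.complexConj L) 2 (Matrix.of fun i j : Fin 2 => if i.val + j.val + 1 = 2 then (1 : L) else 0) (isUnit_antidiagOne_det L 2).ne_zero v t⟩ :
            ↥(localPi L (IsCMField.complexConj L) 2 (Matrix.of fun i j : Fin 2 => if i.val + j.val + 1 = 2 then (1 : L) else 0) v))⁻¹ = ⟨_, mul_mem (mul_mem t.2 t.2) (inv_mem (scalar_det_mem_localPi L (IsCMField.complexConj L) 2 (Matrix.of fun i j : Fin 2 => if i.val + j.val + 1 = 2 then (1 : L) else 0) (isUnit_antidiagOne_det L 2).ne_zero v t))⟩ :=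
      Subtype.ext (by simp only [Subgroup.coe_mul, Subgroup.coe_inv])
    rw [heq]
    exact hmem
  have hcomm : ∀ k t : ↥(localPi L (IsCMField.complexConj L) 2 (Matrix.of fun i j : Fin 2 => if i.val + j.val + 1 = 2 then (1 : L) else 0) v),
      k⁻¹ * t⁻¹ * k * t ∈ Subgroup.closure (⋃ K ∈ {K : Subgroup ↥(localPi L (IsCMField.complexConj L) 2 (Matrix.of fun i j : Fin 2 => if i.val + j.val + 1 = 2 then (1 : L) else 0) v) | IsCompact (K : Set ↥(localPi L (IsCMField.complexConj L) 2 (Matrix.of fun i j : Fin 2 => if i.val + j.val + 1 = 2 then (1 : L) else 0) v))},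
          (K : Set ↥(localPi L (IsCMField.complexConj L) 2 (Matrix.of fun i j : Fin 2 => if i.val + j.val + 1 = 2 then (1 : L) else 0) v))) := fun k t => by
    have hmem := hSU ((k : LocalGLPi L 2 v)⁻¹ * (t : LocalGLPi L 2 v)⁻¹ * (k : LocalGLPi L 2 v) * (t : LocalGLPi L 2 v))
      (mul_mem (mul_mem (mul_mem (inv_mem k.2) (inv_mem t.2)) k.2) t.2)
      fun w => det_apply_commutator_eq_one L 2 v (t : LocalGLPi L 2 v) (k : LocalGLPi L 2 v) w
    have heq : k⁻¹ * t⁻¹ * k * t = ⟨_, mul_mem (mul_mem (mul_mem (inv_mem k.2) (inv_mem t.2)) k.2) t.2⟩ :=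
      Subtype.ext (by simp only [Subgroup.coe_mul, Subgroup.coe_inv])
    rw [heq]
    exact hmem
  exact IrrClass.apply_eq_smul_of_forall_isConstituentOf_eq_mk_ofChar_of_forall_exists_sq_mul_inv_mem_closure
    (P₂.finRep.smoothPart.toRepresentation.comp (inclPlace ↥(maximalRealSubfield L) L (IsCMField.complexConj L) 2 (Matrix.of fun i j : Fin 2 => if i.val + j.val + 1 = 2 then (1 : L) else 0) v))
    (P₂.finRep.isSmooth_smoothPart.comp _ (continuous_inclPlace ↥(maximalRealSubfield L) L (IsCMField.complexConj L) 2 (Matrix.of fun i j : Fin 2 => if i.val + j.val + 1 = 2 then (1 : L) else 0) v))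
    ((cmDetChar L 2 (Matrix.of fun i j : Fin 2 => if i.val + j.val + 1 = 2 then (1 : L) else 0) (ξ.η * ξ.ψ) (isAutomorphic_eta_mul_psi ξ) (isUnit_antidiagOne_det L 2).ne_zero).toMonoidHom.comp
      (inclPlaceAdelic ↥(maximalRealSubfield L) L (IsCMField.complexConj L) 2 (Matrix.of fun i j : Fin 2 => if i.val + j.val + 1 = 2 then (1 : L) else 0) v))
    (isOpen_ker_comp_inclPlaceAdelic
      (cmDetChar L 2 (Matrix.of fun i j : Fin 2 => if i.val + j.val + 1 = 2 then (1 : L) else 0) (ξ.η * ξ.ψ) (isAutomorphic_eta_mul_psi ξ) (isUnit_antidiagOne_det L 2).ne_zero).toMonoidHom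
      (cmDetChar L 2 (Matrix.of fun i j : Fin 2 => if i.val + j.val + 1 = 2 then (1 : L) else 0) (ξ.η * ξ.ψ) (isAutomorphic_eta_mul_psi ξ) (isUnit_antidiagOne_det L 2).ne_zero).continuous v)
    (fun c₀ hc₀ => (isConstituentOf_iff_of_realises₂ P₂ ξ h v c₀).1 hc₀) hcen hcomm g f

/-- **The same on the underlying `L²` vectors**: under `Realises₂ P₂ ξ` and (SU-GEN)_v, for EVERY `g ∈ U(Φ₂)(L⁺_v)` and every `U(Φ₂)(𝔸_f)`-smooth `f ∈ P₂`,
`R(ι_v g) f = (η ψ)(det (ι_v g)) • f` in `L²(U(Φ₂)(L⁺) \ U(Φ₂)(𝔸))`. [cite: Rogawski1990, §13.3 p. 203] [cite: BushnellHenniart2006, §2.3 Lemma; §9.1] -/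
theorem toContRep_inclPlaceAdelic_apply_eq_smul_of_realises₂_of_su
    {μ₂ : Measure (adelicGroupData ↥(maximalRealSubfield L) L (IsCMField.complexConj L) 2 (Matrix.of fun i j : Fin 2 => if i.val + j.val + 1 = 2 then (1 : L) else 0)).automorphicQuotient}
    [(adelicGroupData ↥(maximalRealSubfield L) L (IsCMField.complexConj L) 2 (Matrix.of fun i j : Fin 2 => if i.val + j.val + 1 = 2 then (1 : L) else 0)).IsAutomorphicMeasure μ₂]
    (P₂ : DiscreteAutomorphicRep (adelicGroupData ↥(maximalRealSubfield L) L (IsCMField.complexConj L) 2 (Matrix.of fun i j : Fin 2 => if i.val + j.val + 1 = 2 then (1 : L) else 0)) μ₂) (ξ : OneDimAutRepH L)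
    (h : Realises₂ P₂ ξ) (v : HeightOneSpectrum (𝓞 ↥(maximalRealSubfield L)))
    (hSU : ∀ (u : LocalGLPi L 2 v) (hu : u ∈ localPi L (IsCMField.complexConj L) 2 (Matrix.of fun i j : Fin 2 => if i.val + j.val + 1 = 2 then (1 : L) else 0) v),
      (∀ w : PlacesOver L v, ((u w : GL (Fin 2) (w.1.adicCompletion L)) : Matrix (Fin 2) (Fin 2) (w.1.adicCompletion L)).det = 1) →
        (⟨u, hu⟩ : ↥(localPi L (IsCMField.complexConj L) 2 (Matrix.of fun i j : Fin 2 => if i.val + j.val + 1 = 2 then (1 : L) else 0) v)) ∈ Subgroup.closure (⋃ K ∈ {K : Subgroup ↥(localPi L (IsCMField.complexConj L) 2 (Matrix.of fun i j : Fin 2 => if i.val + j.val + 1 = 2 then (1 : L) else 0) v) | IsCompact (K : Set ↥(localPi L (IsCMField.complexConj L) 2 (Matrix.of fun i j : Fin 2 => if i.val + j.val + 1 = 2 then (1 : L) else 0) v))},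
          (K : Set ↥(localPi L (IsCMField.complexConj L) 2 (Matrix.of fun i j : Fin 2 => if i.val + j.val + 1 = 2 then (1 : L) else 0) v))))
    (g : ↥(localPi L (IsCMField.complexConj L) 2 (Matrix.of fun i j : Fin 2 => if i.val + j.val + 1 = 2 then (1 : L) else 0) v)) (f : ↥P₂.space.toSubmodule) (hf : f ∈ P₂.finRep.smoothPart) :
    P₂.space.toContRep (inclPlaceAdelic ↥(maximalRealSubfield L) L (IsCMField.complexConj L) 2 (Matrix.of fun i j : Fin 2 => if i.val + j.val + 1 = 2 then (1 : L) else 0) v g) f =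
      (((cmDetChar L 2 (Matrix.of fun i j : Fin 2 => if i.val + j.val + 1 = 2 then (1 : L) else 0) (ξ.η * ξ.ψ) (isAutomorphic_eta_mul_psi ξ) (isUnit_antidiagOne_det L 2).ne_zero)
        (inclPlaceAdelic ↥(maximalRealSubfield L) L (IsCMField.complexConj L) 2 (Matrix.of fun i j : Fin 2 => if i.val + j.val + 1 = 2 then (1 : L) else 0) v g) : ℂˣ) : ℂ) • f :=
  congrArg Subtype.val (finRep_smoothPart_inclPlace_apply_eq_smul_of_realises₂_of_su P₂ ξ h v hSU g ⟨f, hf⟩)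

end Summit.HodgeConjecture.HodgeConjecture.Cruxes.H413.F0P3cPKtupleU2LocalIsotypy

end
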